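import Literature.MathematicalPhysics.QuantumFieldTheory.OSFrameProfiles
import Literature.MathematicalPhysics.QuantumFieldTheory.OSPointwiseAnalyticity
import Mathlib.MeasureTheory.Measure.Haar.InnerProductSpace
import HarnessLib

/-!
# Coordinates for the mean-value step: flat real coordinates of configurations, frame directions

Topic `Literature/MathematicalPhysics/QuantumFieldTheory`; support file (all proved; the coordinate
map and the directions as definitions; no named facts) for the mean-value step (6.5)–(6.7) of
Osterwalder–Schrader II, Ch. VI.1. The weighted polydisc mean value property
(`PolydiscWeightedMeanValue.integral_pi_radial_smul_eq_smul`) and the real/imaginary splitting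
(`RayBoundaryValueGrowth.reImEquiv`) are indexed by `Fin N`; configurations of `n` points in `ℝᵈ`
are `Fin n → EuclideanSpace ℝ (Fin d)`. This file provides the glue for `N = n·d`:

* `ucfg u` — the configuration with frame coordinates `u : Fin (n·d) → ℝ`
  (`(ucfg u) j μ = u (finProdFinEquiv (j, μ))`), **measure preserving** (`measurePreserving_ucfg`),
  with `‖ucfg u j‖ ≤ √d ‖u‖`;
* `frameDir ê p` — the complex configuration direction "point `j` along `ê_μ`" (`p ↔ (j, μ)`),
  `‖frameDir ê p‖ ≤ 1` for unit frame vectors, and the **decomposition of the polydisc points**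
  `∑_p w_p • frameDir ê p = cfgPt (frameMap∘ucfg (Re w)) + I • cfgPt (frameMap∘ucfg (Im w))`.

## References

* K. Osterwalder, R. Schrader, *Axioms for Euclidean Green's functions II*, Comm. Math. Phys. 42
  (1975) 281–305, Ch. VI.1 (6.5)–(6.7). [OsterwalderSchraderCMP1975]
-/

noncomputable section

open MeasureTheory Set Metric Complex
open scoped SchwartzMap

namespace Literature.MathematicalPhysics.QuantumFieldTheory

variable {d n : ℕ}

/-! ### Flat coordinates of configurations -/

/-- **The configuration with flat coordinates `u`**: `(ucfg u) j μ = u (finProdFinEquiv (j, μ))`. [folklore] -/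
def ucfg (u : Fin (n * d) → ℝ) : Fin n → EuclideanSpace ℝ (Fin d) :=
  fun j => WithLp.toLp 2 fun μ => u (finProdFinEquiv (j, μ))

/-- Coordinates. [folklore] -/
@[simp] theorem ucfg_apply (u : Fin (n * d) → ℝ) (j : Fin n) (μ : Fin d) : ucfg u j μ = u (finProdFinEquiv (j, μ)) := rfl

/-- `ucfg` is additive. [folklore] -/
theorem ucfg_add (u u' : Fin (n * d) → ℝ) : ucfg (u + u') = ucfg u + ucfg u' := by
  funext j; ext μ; simp

/-- `ucfg` commutes with real scalars. [folklore] -/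
theorem ucfg_smul (a : ℝ) (u : Fin (n * d) → ℝ) : ucfg (a • u) = a • ucfg u := by
  funext j; ext μ; simp

/-- Block norms: `‖ucfg u j‖ ≤ √d ‖u‖`. [folklore] -/
theorem norm_ucfg_le (u : Fin (n * d) → ℝ) (j : Fin n) : ‖ucfg u j‖ ≤ Real.sqrt d * ‖u‖ := by
  have h := QuantumLattice.EuclideanSpace.norm_le_sqrt_card_mul (ucfg u j) (norm_nonneg u) fun μ => by
    rw [ucfg_apply, ← Real.norm_eq_abs]; exact norm_le_pi_norm u _
  simpa using h

/-- Uncurrying `(ℝᵈ-coords)ⁿ → ℝ^{n × d}` preserves Lebesgue measure. [folklore] -/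
theorem measurePreserving_uncurry_pi :
    MeasurePreserving (fun x : Fin n → Fin d → ℝ => fun p : Fin n × Fin d => x p.1 p.2) volume volume := by
  have hmeas : Measurable fun x : Fin n → Fin d → ℝ => fun p : Fin n × Fin d => x p.1 p.2 :=
    measurable_pi_lambda _ fun p => (measurable_pi_apply p.2).comp (measurable_pi_apply p.1)
  refine ⟨hmeas, ?_⟩
  symm
  refine Measure.pi_eq fun s hs => ?_
  rw [Measure.map_apply hmeas (MeasurableSet.univ_pi hs)]
  have hpre : (fun x : Fin n → Fin d → ℝ => fun p : Fin n × Fin d => x p.1 p.2) ⁻¹'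
      Set.univ.pi s = Set.univ.pi fun i => Set.univ.pi fun k => s (i, k) := by
    ext x; simp
  rw [hpre, volume_pi, Measure.pi_pi]
  simp_rw [volume_pi, Measure.pi_pi]
  rw [← Finset.univ_product_univ, Finset.prod_product]

/-- Currying `ℝ^{n × d} → (ℝᵈ-coords)ⁿ` preserves Lebesgue measure. [folklore] -/
theorem measurePreserving_curry_pi :
    MeasurePreserving (fun g : Fin n × Fin d → ℝ => fun (j : Fin n) (μ : Fin d) => g (j, μ)) volume volume := by
  have h := (measurePreserving_uncurry_pi (n := n) (d := d)).symm (MeasurableEquiv.curry (Fin n) (Fin d) ℝ).symm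
  rw [MeasurableEquiv.symm_symm, MeasurableEquiv.coe_curry] at h
  exact h

/-- **`ucfg` is measure preserving** (flat Lebesgue measure to the product of the Euclidean volumes). [folklore] -/
theorem measurePreserving_ucfg : MeasurePreserving (ucfg : (Fin (n * d) → ℝ) → (Fin n → EuclideanSpace ℝ (Fin d))) volume volume := by
  -- reindex `Fin (n d) → Fin n × Fin d`
  have h1 : MeasurePreserving (fun (u : Fin (n * d) → ℝ) (q : Fin n × Fin d) => u (finProdFinEquiv q)) volume volume := by
    have h := (volume_measurePreserving_piCongrLeft (fun _ : Fin (n * d) => ℝ) (finProdFinEquiv : Fin n × Fin d ≃ Fin (n * d))).symm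
      (MeasurableEquiv.piCongrLeft (fun _ : Fin (n * d) => ℝ) finProdFinEquiv)
    have hfun : (⇑((MeasurableEquiv.piCongrLeft (fun _ : Fin (n * d) => ℝ) (finProdFinEquiv : Fin n × Fin d ≃ Fin (n * d))).symm) :
        (Fin (n * d) → ℝ) → (Fin n × Fin d → ℝ)) = fun u q => u (finProdFinEquiv q) := by
      funext u q
      exact Equiv.piCongrLeft_symm_apply (P := fun _ : Fin (n * d) => ℝ) (e := finProdFinEquiv) u q
    rwa [hfun] at h
  -- curry and pass to `EuclideanSpace` blockwise
  have h3 : MeasurePreserving (fun (a : Fin n → Fin d → ℝ) (j : Fin n) => WithLp.toLp 2 (a j)) volume volume :=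
    volume_preserving_pi fun _ : Fin n => PiLp.volume_preserving_toLp (Fin d)
  have hcomp : (ucfg : (Fin (n * d) → ℝ) → (Fin n → EuclideanSpace ℝ (Fin d))) =
      (fun (a : Fin n → Fin d → ℝ) (j : Fin n) => WithLp.toLp 2 (a j)) ∘
        (fun g : Fin n × Fin d → ℝ => fun (j : Fin n) (μ : Fin d) => g (j, μ)) ∘
        fun (u : Fin (n * d) → ℝ) (q : Fin n × Fin d) => u (finProdFinEquiv q) := rfl
  rw [hcomp]
  exact h3.comp (measurePreserving_curry_pi.comp h1)

/-- `ucfg` as a measurable equivalence. [folklore] -/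
def ucfgEquiv : (Fin (n * d) → ℝ) ≃ᵐ (Fin n → EuclideanSpace ℝ (Fin d)) :=
  ((MeasurableEquiv.piCongrLeft (fun _ : Fin (n * d) => ℝ) (finProdFinEquiv : Fin n × Fin d ≃ Fin (n * d))).symm.trans
    (MeasurableEquiv.curry (Fin n) (Fin d) ℝ)).trans
    (MeasurableEquiv.piCongrRight fun _ : Fin n => MeasurableEquiv.toLp 2 (Fin d → ℝ))

/-- The measurable equivalence is `ucfg`. [folklore] -/
theorem coe_ucfgEquiv : (⇑(ucfgEquiv : (Fin (n * d) → ℝ) ≃ᵐ (Fin n → EuclideanSpace ℝ (Fin d)))) = ucfg := by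
  funext u j
  ext μ
  simp only [ucfgEquiv, MeasurableEquiv.trans_apply, MeasurableEquiv.piCongrRight, ucfg_apply]
  change (WithLp.toLp 2 ((MeasurableEquiv.curry (Fin n) (Fin d) ℝ)
    ((MeasurableEquiv.piCongrLeft (fun _ : Fin (n * d) => ℝ) (finProdFinEquiv : Fin n × Fin d ≃ Fin (n * d))).symm u) j)) μ = _
  rw [PiLp.toLp_apply, MeasurableEquiv.coe_curry]
  exact Equiv.piCongrLeft_symm_apply (P := fun _ : Fin (n * d) => ℝ) (e := finProdFinEquiv) u (j, μ)

/-- **Integrals transfer**: `∫ Φ(ucfg u) du = ∫ Φ(c) dc`. [folklore] -/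
theorem integral_comp_ucfg {F : Type*} [NormedAddCommGroup F] [NormedSpace ℝ F] (Φ : (Fin n → EuclideanSpace ℝ (Fin d)) → F) :
    ∫ u : Fin (n * d) → ℝ, Φ (ucfg u) = ∫ c : Fin n → EuclideanSpace ℝ (Fin d), Φ c := by
  have hemb : MeasurableEmbedding (ucfg : (Fin (n * d) → ℝ) → (Fin n → EuclideanSpace ℝ (Fin d))) := by
    rw [← coe_ucfgEquiv]; exact (ucfgEquiv : (Fin (n * d) → ℝ) ≃ᵐ (Fin n → EuclideanSpace ℝ (Fin d))).measurableEmbedding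
  exact measurePreserving_ucfg.integral_comp hemb Φ

/-! ### The frame directions -/

variable (ê : Fin d → EuclideanSpace ℝ (Fin d))

/-- **The complex configuration direction** "point `j` along `ê_μ`", `p ↔ (j, μ)`. [folklore] -/
def frameDir (p : Fin (n * d)) : Fin n → Fin d → ℂ :=
  fun j μ' => if j = (finProdFinEquiv.symm p).1 then ((ê (finProdFinEquiv.symm p).2 μ' : ℝ) : ℂ) else 0

/-- **Norm of the directions**: `‖frameDir ê p‖ ≤ 1` for unit frame vectors. [folklore] -/
theorem norm_frameDir_le (hê1 : ∀ μ, ‖ê μ‖ = 1) (p : Fin (n * d)) : ‖frameDir ê p‖ ≤ 1 := by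
  refine (pi_norm_le_iff_of_nonneg zero_le_one).2 fun j => (pi_norm_le_iff_of_nonneg zero_le_one).2 fun μ' => ?_
  simp only [frameDir]
  split_ifs
  · rw [Complex.norm_real, Real.norm_eq_abs]
    have h := PiLp.norm_apply_le (ê (finProdFinEquiv.symm p).2) μ'
    rw [Real.norm_eq_abs, hê1] at h
    exact h
  · simp

/-- **Decomposition of the polydisc points**: `∑_p w_p • frameDir ê p` is the complex configuration
with entries `∑_μ w_{(j,μ)} ê_μ(μ')`. [folklore] -/
theorem sum_smul_frameDir (w : Fin (n * d) → ℂ) :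
    ∑ p, w p • frameDir ê p = fun j μ' => ∑ μ, w (finProdFinEquiv (j, μ)) * ((ê μ μ' : ℝ) : ℂ) := by
  funext j μ'
  rw [Finset.sum_apply, Finset.sum_apply]
  simp only [Pi.smul_apply, smul_eq_mul, frameDir]
  rw [← Equiv.sum_comp (finProdFinEquiv : Fin n × Fin d ≃ Fin (n * d)), Fintype.sum_prod_type]
  simp only [Equiv.symm_apply_apply, mul_ite, mul_zero]
  rw [Finset.sum_eq_single j (fun j' _ hj' => by simp [Ne.symm hj']) (by simp)]
  simp

/-- The real configuration `frameMap∘(ucfg u)` as a complex point. [folklore] -/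
theorem cfgPt_frameMap_ucfg (hli : LinearIndependent ℝ ê) (u : Fin (n * d) → ℝ) :
    cfgPt (fun j => frameMap ê hli (ucfg u j)) = fun j μ' => ∑ μ, ((u (finProdFinEquiv (j, μ)) : ℝ) : ℂ) * ((ê μ μ' : ℝ) : ℂ) := by
  funext j μ'
  rw [cfgPt_apply, frameMap_apply]
  simp [Finset.sum_apply]

/-- **The polydisc points are tube points**:
`∑_p w_p • frameDir ê p = cfgPt (frameMap∘ucfg (Re w)) + I • cfgPt (frameMap∘ucfg (Im w))`. [folklore] -/
theorem sum_smul_frameDir_eq (hli : LinearIndependent ℝ ê) (w : Fin (n * d) → ℂ) :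
    ∑ p, w p • frameDir ê p = cfgPt (fun j => frameMap ê hli (ucfg (fun p => (w p).re) j)) +
      (I : ℂ) • cfgPt (fun j => frameMap ê hli (ucfg (fun p => (w p).im) j)) := by
  rw [sum_smul_frameDir, cfgPt_frameMap_ucfg, cfgPt_frameMap_ucfg]
  funext j μ'
  simp only [Pi.add_apply, Pi.smul_apply, smul_eq_mul, Finset.mul_sum, ← Finset.sum_add_distrib]
  refine Finset.sum_congr rfl fun μ _ => ?_
  set z : ℂ := w (finProdFinEquiv (j, μ)) with hz
  conv_lhs => rw [← Complex.re_add_im z]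
  ring

end Literature.MathematicalPhysics.QuantumFieldTheory
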